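import Literature.MathematicalPhysics.QuantumFieldTheory.Balaban1983to89.B8SectAStatements
import Literature.MathematicalPhysics.QuantumFieldTheory.Balaban1983to89.B8Eq111SiteCovariance
import Literature.MathematicalPhysics.QuantumFieldTheory.Balaban1983to89.B15DeterminingSets

/-!
# `Balaban1983to89.B8Eq17ClassAkV1` — T. Bałaban, *Spaces of regular gauge field configurations on a lattice and gauge
# fixing conditions*, Commun. Math. Phys. **99** (1985) 75–102 [Balaban1985RegularSpaces]: the space `𝔄_k({Ω_j}, α₀)` of
# (1.7)–(1.9) p. 77 — its BOND CLAUSE (1.9) and the full class — as NAMED predicates on the carriers of record (V1: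
# `Setup.GaugeField P j G`, `LatticeFieldCalculus.covDivPlaq`), TWINS BY DESIGN of the ℤᵈ declarations of record
# `B8Ineq132.CondAt` / `B8Ineq132.InAk`

statement-level skeleton of published theorems with citation tags; proofs where landed; nothing here is a claim about the Yang–Mills mass gap

PDF held: `paper:balaban1985-cmp99-regular-spaces-gauge-fixing` (journal page = PDF page + 74); p. 77 [PDF 3] read as text
(`p0003.txt`) for this file.

CITATION HEADER — WHAT IS REPRODUCED.  SKELETON row B8.Eq1.7 ((1.7)–(1.9): DEF of the space `𝔄_k({Ω_j}, α₀)`; owner r05,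
`HOME/lit-balaban-r05/ROWS-B8.md`), closing its caveat «the bond clause (1.9) is typed on the ℤᵈ carrier only
(`B8Ineq132.CondAt`)», and the companion sentence of row B8.Eq1.11 «Thus the space 𝔄_k({Ω_j}, α₀) is invariant with respect to
gauge transformations» for the NAMED class.  Print, p. 77, verbatim: *"The sets Ω_j are identified with sets of bonds, or
sets of plaquettes, in the following way. If Ω ⊂ T_η then we denote by Ω also the set of bonds ⋃_{x∈Ω} st(x) = {bonds b ⊂ T:
at least one end-point of b belongs to Ω}. Similarly for the corresponding set of plaquettes. This convention applies to an
arbitrary lattice. … for a sequence (1.3) and a positive number α₀ we define 𝔄_k({Ω_j}, α₀) as a set of all gauge field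
configurations U on T_η satisfying the conditions |U(∂p) − 1| < α₀L^{−2j} for p ∈ Ω_j, j = 0, 1, …, k, (1.7) or
|U(∂p) − 1| < α₀η²(Lʲη)⁻² for p ∈ Ω_j, (1.8) |(D^{η*}_U ∂U)(b)| < α₀L^{−2j}(Lʲη)⁻¹ for b ∈ Ω_j, j = 0, 1, …, k. (1.9) …
These conditions are invariant with respect to gauge transformations. … Thus the space 𝔄_k({Ω_j}, α₀) is invariant with
respect to gauge transformations."*

TWINS BY DESIGN (B8 owner r05 g3, `HOME/lit-balaban-p40/INBOX.md` 2026-08-21T02:45Z; definitions steward r20 to register the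
pair).  The ℤᵈ declarations OF RECORD are `B8Ineq132.CondAt L η α j S V` ((1.7) ∧ (1.9) at one level on one SITE set `S`,
touching convention `PlaqTouches` / `BondTouches`) and `B8Ineq132.InAk L k η α Ω V` (`∀ j ≤ k`), over `Site d = Fin d → ℤ`,
`V : Site d → Fin d → 𝔸ˣ`, `R` = conjugation in a Banach algebra `𝔸`.  THIS FILE states the same two objects on V1 with
the SAME thresholds (`α₀·((Lʲ)²)⁻¹` for (1.7) — the shape of `B8SectAStatements.InAkOn` —, `α₀·((Lʲ)²)⁻¹·(Lʲη)⁻¹` for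
(1.9); `((Lʲ)²)⁻¹ = ((Lʲ)⁻¹)²` is `inv_pow`) and the same touching convention: `plaqsOf S` (plaquettes with a corner in `S`,
twin of `B8Ineq132.PlaqTouches`) and the EXISTING `B15DeterminingSets.bondsOf S` (bonds with an end-point in `S`, twin of
`B8Ineq132.BondTouches`; reused, not re-declared).  On V1 the representation is a PARAMETER: the bond clause is stated
relative to a linear action `R : G → V →ₗ[ℝ] V` and a reading `ι : G → V` of the plaquette variables in `V` (print:
`V = M_N(ℂ)`, `R(u)X = uXu⁻¹`, `ι` the inclusion `G ⊂ U(N) ⊂ M_N(ℂ)`, `|·|` the operator norm), exactly as in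
`B8Eq111SiteCovariance` §§1–4 whose theorems are the API below.

WHAT IS TYPED / PROVED HERE (definitions with bodies; API kernel-checked, no `sorry`, standard axioms):
* `plaqsOf S` — the p. 77 convention for plaquettes; `mem_plaqsOf`, `plaqsOf_mono`, `plaqsOf_univ` (and `bondsOf_univ` for
  the reused bond convention);
* `BondClause19 R ι Ωb k η L α₀ U` — **(1.9)** for `j = 0, …, k` over a family of bond sets `Ωb` (parallel to
  `B8SectAStatements.InAkOn`, which takes plaquette sets); `bondClause19_iff`, `bondClause19_iff_condAtShape` (the
  `B8Ineq132` threshold shape), `bondClause19_mono` (in `α₀`, for `0 ≤ η`), `bondClause19_of_le` (fewer levels),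
  `bondClause19_anti_set`, `bondClause19_gaugeAct_iff` (= `B8Eq111SiteCovariance.bondClause19_gaugeAct_iff`),
  `bondClause19_one` (non-vacuity: `U ≡ 1`);
* `ClassAk R ι Ω k η L α₀ U` — **`U ∈ 𝔄_k({Ω_j}, α₀)`** for a family of SITE sets `Ω j ⊂ T` (the print's domains (1.3)):
  (1.7) on `plaqsOf (Ω j)` (`B8SectAStatements.InAkOn`) ∧ (1.9) on `bondsOf (Ω j)`; `classAk_iff`, `classAk_mono`,
  `classAk_of_le`, `classAk_gaugeAct_iff` (the printed *"Thus the space 𝔄_k({Ω_j}, α₀) is invariant"*, from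
  `B8Eq111SiteCovariance.classAk_gaugeAct_iff`), `classAk_one` (`1 ∈ 𝔄_k` for `α₀ > 0`, `L ≥ 1`, `η > 0`).
DELIBERATELY NOT HERE: the geometric conditions (1.3)–(1.6) on the sequence `{Ω_j}` (`B8SectAStatements.MetricClause14`,
ℤᵈ `B8ConstraintBonds.DomainSeq`) — `ClassAk` is stated for an ARBITRARY family of site sets, as `B8Ineq132.InAk` is; the
remark *"it is enough to assume that (1.7), (1.9) hold for p, b ∈ Bʲ(Λ_j)"* (its threshold arithmetic is
`B8SectAStatements.threshold_anti`); (1.10) (`B8SectAStatements.InAkWilson`); no estimate of B8.  Nothing here is new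
mathematics.

Unit `lit-balaban-p40` (Phase-2 proof seat p40, gen 2 `literature-prover-lit-balaban-p40-g2-0`; definition request of the B8
owner r05), HOME `run/shared/lean/pub/lit-balaban/` (seat dir `lit-balaban-p40/`), 2026-08-21.
-/

namespace Literature.MathematicalPhysics.QuantumFieldTheory.Balaban1983to89.B8Eq17ClassAkV1

open Literature.MathematicalPhysics.QuantumFieldTheory.Balaban1983to89
open LatticeFieldCalculus GaugeField

variable {P : Params} {j : ℕ} {G : Type*} [GaugeGroup G]

/-! ## §1 The p. 77 convention: a site set `Ω` as a set of plaquettes / bonds -/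

/-- **p. 77 convention, plaquettes**, verbatim: *"If Ω ⊂ T_η then we denote by Ω also the set of bonds ⋃_{x∈Ω} st(x) = {bonds
b ⊂ T: at least one end-point of b belongs to Ω}. Similarly for the corresponding set of plaquettes."* — the plaquettes
`p = ⟨x, x+e_μ, x+e_μ+e_ν, x+e_ν⟩` with at least one corner in `S` (V1 twin of `B8Ineq132.PlaqTouches`; the bond half is the
existing `B15DeterminingSets.bondsOf`). [cite: Balaban1985RegularSpaces, p.77 (convention before (1.5))] -/
def plaqsOf (S : Set (Site P j)) : Set (Plaq P j) :=
  {p | p.src ∈ S ∨ p.src.shift p.μ ∈ S ∨ p.src.shift p.ν ∈ S ∨ (p.src.shift p.μ).shift p.ν ∈ S}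

/-- Unfolding of `plaqsOf`. [cite: Balaban1985RegularSpaces, p.77 (convention before (1.5))] -/
theorem mem_plaqsOf (S : Set (Site P j)) (p : Plaq P j) :
    p ∈ plaqsOf S ↔ p.src ∈ S ∨ p.src.shift p.μ ∈ S ∨ p.src.shift p.ν ∈ S ∨ (p.src.shift p.μ).shift p.ν ∈ S :=
  Iff.rfl

/-- `plaqsOf` is monotone in the site set. [cite: Balaban1985RegularSpaces, p.77 (convention before (1.5))] -/
theorem plaqsOf_mono {S T : Set (Site P j)} (h : S ⊆ T) : plaqsOf S ⊆ plaqsOf T := by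
  intro p hp
  rcases hp with h1 | h2 | h3 | h4
  · exact Or.inl (h h1)
  · exact Or.inr (Or.inl (h h2))
  · exact Or.inr (Or.inr (Or.inl (h h3)))
  · exact Or.inr (Or.inr (Or.inr (h h4)))

/-- The case *"Ω_j = T_η"* admitted on p. 77: all plaquettes. [cite: Balaban1985RegularSpaces, p.77 (convention before (1.5))] -/
theorem plaqsOf_univ : plaqsOf (Set.univ : Set (Site P j)) = Set.univ :=
  Set.eq_univ_of_forall fun _ => Or.inl trivial

/-- The case *"Ω_j = T_η"*: all bonds (for the reused `B15DeterminingSets.bondsOf`).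
[cite: Balaban1985RegularSpaces, p.77 (convention before (1.5))] -/
theorem bondsOf_univ : B15DeterminingSets.bondsOf (Set.univ : Set (Site P j)) = Set.univ :=
  Set.eq_univ_of_forall fun _ => Or.inl trivial

/-! ## §2 The bond clause (1.9) -/

section BondClause

variable {V : Type*} [NormedAddCommGroup V] [NormedSpace ℝ V]

/-- **(1.9)** p. 77 [PDF 3], verbatim: *"|(D^{η*}_U ∂U)(b)| < α₀L^{−2j}(Lʲη)⁻¹ for b ∈ Ω_j, j = 0, 1, …, k. (1.9)"* — the bond
clause of `𝔄_k({Ω_j}, α₀)` for a family of BOND sets `Ωb j` (parallel to `B8SectAStatements.InAkOn`, which takes plaquette sets),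
the covariant divergence (1.2) `LatticeFieldCalculus.covDivPlaq` with lattice factor `η⁻¹` applied to the plaquette field
`p ↦ ι(U(∂p))`, relative to a linear action `R : G → V →ₗ[ℝ] V` and a reading `ι : G → V` (print: `R(u)X = uXu⁻¹` on
`M_N(ℂ) ⊃ U(N) ⊃ G`, `ι` the inclusion, `|·|` the operator norm).  Thresholds `α₀·((Lʲ)²)⁻¹·(Lʲη)⁻¹` (the shape of `InAkOn`;
`= α₀·((Lʲ)⁻¹)²·(Lʲη)⁻¹` of `B8Ineq132.CondAt`, `bondClause19_iff_condAtShape`).  V1 TWIN BY DESIGN of the bond half of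
`B8Ineq132.CondAt` / `B8Ineq132.InAk`. [cite: Balaban1985RegularSpaces, (1.9) p.77] -/
def BondClause19 (R : G → V →ₗ[ℝ] V) (ι : G → V) (Ωb : ℕ → Set (PBond P j)) (k : ℕ) (η : ℝ) (L : ℕ) (α₀ : ℝ)
    (U : GaugeField P j G) : Prop :=
  ∀ l ≤ k, ∀ b ∈ Ωb l, ‖covDivPlaq R η⁻¹ U (fun p => ι (plaqHol U p)) b‖
      < α₀ * (((L : ℝ) ^ l) ^ 2)⁻¹ * ((L : ℝ) ^ l * η)⁻¹

/-- Unfolding of (1.9). [cite: Balaban1985RegularSpaces, (1.9) p.77] -/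
theorem bondClause19_iff (R : G → V →ₗ[ℝ] V) (ι : G → V) (Ωb : ℕ → Set (PBond P j)) (k : ℕ) (η : ℝ) (L : ℕ)
    (α₀ : ℝ) (U : GaugeField P j G) :
    BondClause19 R ι Ωb k η L α₀ U ↔
      ∀ l ≤ k, ∀ b ∈ Ωb l, ‖covDivPlaq R η⁻¹ U (fun p => ι (plaqHol U p)) b‖
        < α₀ * (((L : ℝ) ^ l) ^ 2)⁻¹ * ((L : ℝ) ^ l * η)⁻¹ :=
  Iff.rfl

/-- (1.9) with the thresholds written in the shape of the ℤᵈ twin `B8Ineq132.CondAt`, `α₀·((Lʲ)⁻¹)²·(Lʲη)⁻¹`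
(`((Lʲ)²)⁻¹ = ((Lʲ)⁻¹)²`). [cite: Balaban1985RegularSpaces, (1.9) p.77] -/
theorem bondClause19_iff_condAtShape (R : G → V →ₗ[ℝ] V) (ι : G → V) (Ωb : ℕ → Set (PBond P j)) (k : ℕ) (η : ℝ)
    (L : ℕ) (α₀ : ℝ) (U : GaugeField P j G) :
    BondClause19 R ι Ωb k η L α₀ U ↔
      ∀ l ≤ k, ∀ b ∈ Ωb l, ‖covDivPlaq R η⁻¹ U (fun p => ι (plaqHol U p)) b‖
        < α₀ * (((L : ℝ) ^ l)⁻¹) ^ 2 * ((L : ℝ) ^ l * η)⁻¹ := by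
  simp only [BondClause19, inv_pow]

/-- (1.9) is monotone in `α₀` (for `η ≥ 0`, so that the thresholds are non-negative multiples of `α₀`).
[cite: Balaban1985RegularSpaces, (1.9) p.77] -/
theorem bondClause19_mono {R : G → V →ₗ[ℝ] V} {ι : G → V} {Ωb : ℕ → Set (PBond P j)} {k : ℕ} {η : ℝ} (hη : 0 ≤ η)
    {L : ℕ} {α₀ α₀' : ℝ} (h : α₀ ≤ α₀') {U : GaugeField P j G} (hU : BondClause19 R ι Ωb k η L α₀ U) :
    BondClause19 R ι Ωb k η L α₀' U := by
  intro l hl b hb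
  refine (hU l hl b hb).trans_le ?_
  have h1 : 0 ≤ (((L : ℝ) ^ l) ^ 2)⁻¹ := by positivity
  have h2 : 0 ≤ ((L : ℝ) ^ l * η)⁻¹ := by positivity
  exact mul_le_mul_of_nonneg_right (mul_le_mul_of_nonneg_right h h1) h2

/-- Fewer levels: (1.9) for `k` implies (1.9) for every `k' ≤ k`. [cite: Balaban1985RegularSpaces, (1.9) p.77] -/
theorem bondClause19_of_le {R : G → V →ₗ[ℝ] V} {ι : G → V} {Ωb : ℕ → Set (PBond P j)} {k k' : ℕ} (hk : k' ≤ k)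
    {η : ℝ} {L : ℕ} {α₀ : ℝ} {U : GaugeField P j G} (hU : BondClause19 R ι Ωb k η L α₀ U) :
    BondClause19 R ι Ωb k' η L α₀ U :=
  fun l hl => hU l (hl.trans hk)

/-- (1.9) restricts to smaller bond sets at every level. [cite: Balaban1985RegularSpaces, (1.9) p.77] -/
theorem bondClause19_anti_set {R : G → V →ₗ[ℝ] V} {ι : G → V} {Ωb Ωb' : ℕ → Set (PBond P j)}
    (hΩ : ∀ l, Ωb' l ⊆ Ωb l) {k : ℕ} {η : ℝ} {L : ℕ} {α₀ : ℝ} {U : GaugeField P j G}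
    (hU : BondClause19 R ι Ωb k η L α₀ U) : BondClause19 R ι Ωb' k η L α₀ U :=
  fun l hl b hb => hU l hl b (hΩ l hb)

/-- **(1.9) is gauge invariant** (p. 77: *"To see that (1.9) is invariant also … (1.11). This and (1.2) imply the
invariance."*) — for the NAMED clause: `U^u ∈ (1.9) ↔ U ∈ (1.9)`, `R` a representation (`hone`, `hmul`), `ι` intertwining
(`hι`), `R(u(x))` isometric (`hiso`); this is `B8Eq111SiteCovariance.bondClause19_gaugeAct_iff`.
[cite: Balaban1985RegularSpaces, (1.9) p.77] -/
theorem bondClause19_gaugeAct_iff {R : G → V →ₗ[ℝ] V} (hone : ∀ v, R 1 v = v)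
    (hmul : ∀ (g h : G) (v : V), R (g * h) v = R g (R h v)) {ι : G → V}
    (hι : ∀ g h : G, ι (g * h * g⁻¹) = R g (ι h)) {u : GaugeTransf P j G}
    (hiso : ∀ (x : Site P j) (v : V), ‖R (u x) v‖ = ‖v‖) (Ωb : ℕ → Set (PBond P j)) (k : ℕ) (η : ℝ) (L : ℕ)
    (α₀ : ℝ) (U : GaugeField P j G) :
    BondClause19 R ι Ωb k η L α₀ (gaugeAct u U) ↔ BondClause19 R ι Ωb k η L α₀ U :=
  B8Eq111SiteCovariance.bondClause19_gaugeAct_iff hone hmul hι hiso Ωb k L η α₀ U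

/-- The trivial configuration has trivial plaquette variables: `1(∂p) = 1`. [folklore] -/
private theorem plaqHol_one (p : Plaq P j) : plaqHol (1 : GaugeField P j G) p = 1 := by
  simp [plaqHol, show ∀ b, (1 : GaugeField P j G) b = 1 from fun _ => rfl]

omit [NormedSpace ℝ V] in
/-- At `U ≡ 1` and `R(1) = 1` the covariant divergence (1.2) of a CONSTANT plaquette field vanishes (every backward covariant
derivative (1.1) of a constant is `η⁻¹(R(1)v − v) = 0`). [cite: Balaban1985RegularSpaces, (1.2) p.76] -/
theorem covDivPlaq_one_const [Module ℝ V] {R : G → V →ₗ[ℝ] V} (hone : ∀ v, R 1 v = v) (c : ℝ) (v : V) (b : PBond P j) :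
    covDivPlaq R c (1 : GaugeField P j G) (fun _ => v) b = 0 := by
  have h0 : ∀ (ν : Fin P.d) (x : Site P j), covDAdj R c (1 : GaugeField P j G) ν (fun _ : Site P j => v) x = 0 := by
    intro ν x
    simp [covDAdj, show ∀ b, (1 : GaugeField P j G) b = 1 from fun _ => rfl, hone]
  simp [covDivPlaq, h0]

/-- **Non-vacuity of (1.9)**: `U ≡ 1` satisfies (1.9) on any bond sets as soon as the thresholds are positive (`α₀ > 0`, `L ≥ 1`,
`η > 0`), since `(D^{η*}_1 ∂1)(b) = 0` (`R(1) = 1`). [cite: Balaban1985RegularSpaces, (1.9) p.77] -/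
theorem bondClause19_one {R : G → V →ₗ[ℝ] V} (hone : ∀ v, R 1 v = v) (ι : G → V) (Ωb : ℕ → Set (PBond P j)) (k : ℕ)
    {η : ℝ} (hη : 0 < η) {L : ℕ} (hL : 1 ≤ L) {α₀ : ℝ} (h0 : 0 < α₀) :
    BondClause19 R ι Ωb k η L α₀ (1 : GaugeField P j G) := by
  intro l _ b _
  have hF : (fun p : Plaq P j => ι (plaqHol (1 : GaugeField P j G) p)) = fun _ => ι 1 :=
    funext fun p => by rw [plaqHol_one]
  rw [hF, covDivPlaq_one_const hone, norm_zero]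
  have : (0 : ℝ) < L := by exact_mod_cast hL
  positivity

end BondClause

/-! ## §3 The class `𝔄_k({Ω_j}, α₀)` = (1.7) ∧ (1.9) -/

section ClassAk

variable {V : Type*} [NormedAddCommGroup V] [NormedSpace ℝ V]

/-- **`U ∈ 𝔄_k({Ω_j}, α₀)`** p. 77 [PDF 3], verbatim: *"for a sequence (1.3) and a positive number α₀ we define 𝔄_k({Ω_j}, α₀)
as a set of all gauge field configurations U on T_η satisfying the conditions |U(∂p) − 1| < α₀L^{−2j} for p ∈ Ω_j,
j = 0, 1, …, k, (1.7) … |(D^{η*}_U ∂U)(b)| < α₀L^{−2j}(Lʲη)⁻¹ for b ∈ Ω_j, j = 0, 1, …, k. (1.9)"* — for a family of SITE sets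
`Ω j ⊂ T` (the domains (1.3); no geometric condition (1.4) is imposed here) read as plaquette / bond sets by the p. 77
convention (`plaqsOf`, `B15DeterminingSets.bondsOf`): the plaquette clause is `B8SectAStatements.InAkOn`, the bond clause
`BondClause19` (relative to `R`, `ι` as there).  V1 TWIN BY DESIGN of `B8Ineq132.InAk`.
[cite: Balaban1985RegularSpaces, (1.7)–(1.9) p.77] -/
def ClassAk (R : G → V →ₗ[ℝ] V) (ι : G → V) (Ω : ℕ → Set (Site P j)) (k : ℕ) (η : ℝ) (L : ℕ) (α₀ : ℝ)
    (U : GaugeField P j G) : Prop :=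
  B8SectAStatements.InAkOn (fun l => plaqsOf (Ω l)) k L α₀ U ∧
    BondClause19 R ι (fun l => B15DeterminingSets.bondsOf (Ω l)) k η L α₀ U

/-- Unfolding of `𝔄_k({Ω_j}, α₀)` into its two printed clauses. [cite: Balaban1985RegularSpaces, (1.7)–(1.9) p.77] -/
theorem classAk_iff (R : G → V →ₗ[ℝ] V) (ι : G → V) (Ω : ℕ → Set (Site P j)) (k : ℕ) (η : ℝ) (L : ℕ) (α₀ : ℝ)
    (U : GaugeField P j G) :
    ClassAk R ι Ω k η L α₀ U ↔
      (∀ l ≤ k, ∀ p ∈ plaqsOf (Ω l), dist1 (plaqHol U p) < α₀ * (((L : ℝ) ^ l) ^ 2)⁻¹) ∧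
        ∀ l ≤ k, ∀ b ∈ B15DeterminingSets.bondsOf (Ω l), ‖covDivPlaq R η⁻¹ U (fun p => ι (plaqHol U p)) b‖
          < α₀ * (((L : ℝ) ^ l) ^ 2)⁻¹ * ((L : ℝ) ^ l * η)⁻¹ :=
  Iff.rfl

/-- `𝔄_k({Ω_j}, α₀)` grows with `α₀` (for `η ≥ 0`). [cite: Balaban1985RegularSpaces, (1.7)–(1.9) p.77] -/
theorem classAk_mono {R : G → V →ₗ[ℝ] V} {ι : G → V} {Ω : ℕ → Set (Site P j)} {k : ℕ} {η : ℝ} (hη : 0 ≤ η) {L : ℕ}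
    {α₀ α₀' : ℝ} (h : α₀ ≤ α₀') {U : GaugeField P j G} (hU : ClassAk R ι Ω k η L α₀ U) : ClassAk R ι Ω k η L α₀' U :=
  ⟨B8SectAStatements.inAkOn_mono h hU.1, bondClause19_mono hη h hU.2⟩

/-- `𝔄_k ⊂ 𝔄_{k'}` for `k' ≤ k` (fewer levels constrained). [cite: Balaban1985RegularSpaces, (1.7)–(1.9) p.77] -/
theorem classAk_of_le {R : G → V →ₗ[ℝ] V} {ι : G → V} {Ω : ℕ → Set (Site P j)} {k k' : ℕ} (hk : k' ≤ k) {η : ℝ}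
    {L : ℕ} {α₀ : ℝ} {U : GaugeField P j G} (hU : ClassAk R ι Ω k η L α₀ U) : ClassAk R ι Ω k' η L α₀ U :=
  ⟨B8SectAStatements.inAkOn_of_le hk hU.1, bondClause19_of_le hk hU.2⟩

/-- **"Thus the space 𝔄_k({Ω_j}, α₀) is invariant with respect to gauge transformations."** (p. 77) — for the NAMED class:
`U^u ∈ 𝔄_k({Ω_j}, α₀) ↔ U ∈ 𝔄_k({Ω_j}, α₀)` for every gauge transformation `u` with isometric `R(u(x))` (`R` a
representation, `ι` intertwining); this is `B8Eq111SiteCovariance.classAk_gaugeAct_iff`.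
[cite: Balaban1985RegularSpaces, (1.7)–(1.9) p.77] -/
theorem classAk_gaugeAct_iff {R : G → V →ₗ[ℝ] V} (hone : ∀ v, R 1 v = v)
    (hmul : ∀ (g h : G) (v : V), R (g * h) v = R g (R h v)) {ι : G → V}
    (hι : ∀ g h : G, ι (g * h * g⁻¹) = R g (ι h)) {u : GaugeTransf P j G}
    (hiso : ∀ (x : Site P j) (v : V), ‖R (u x) v‖ = ‖v‖) (Ω : ℕ → Set (Site P j)) (k : ℕ) (η : ℝ) (L : ℕ) (α₀ : ℝ)
    (U : GaugeField P j G) :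
    ClassAk R ι Ω k η L α₀ (gaugeAct u U) ↔ ClassAk R ι Ω k η L α₀ U :=
  B8Eq111SiteCovariance.classAk_gaugeAct_iff hone hmul hι hiso (fun l => plaqsOf (Ω l))
    (fun l => B15DeterminingSets.bondsOf (Ω l)) k L η α₀ U

/-- **Non-vacuity**: `U ≡ 1 ∈ 𝔄_k({Ω_j}, α₀)` for every family `Ω`, every `k`, as soon as `α₀ > 0`, `L ≥ 1`, `η > 0`
(`|1 − 1| = 0`, `(D^{η*}_1 ∂1)(b) = 0`; `R(1) = 1`). [cite: Balaban1985RegularSpaces, (1.7)–(1.9) p.77] -/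
theorem classAk_one {R : G → V →ₗ[ℝ] V} (hone : ∀ v, R 1 v = v) (ι : G → V) (Ω : ℕ → Set (Site P j)) (k : ℕ) {η : ℝ}
    (hη : 0 < η) {L : ℕ} (hL : 1 ≤ L) {α₀ : ℝ} (h0 : 0 < α₀) : ClassAk R ι Ω k η L α₀ (1 : GaugeField P j G) :=
  ⟨B8SectAStatements.inAkOn_one _ k hL h0, bondClause19_one hone ι _ k hη hL h0⟩

end ClassAk

end Literature.MathematicalPhysics.QuantumFieldTheory.Balaban1983to89.B8Eq17ClassAkV1
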